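import Literature.IUT.HodgeTheaters.ConventionsCatIsomorphismLift
import Literature.IUT.HodgeTheaters.GoodLocalFrobenioidOfPlaceEx33iii
import HarnessLib

/-!
# [IUTchI] Example 3.3 (iii) (a), (d) ON ISOMORPHISMS OF CATEGORIES: the induced homomorphisms (our §0 reading)
# `Aut(𝒟_v) → Aut(𝒟⊢_v)` and `Aut(ℱ̲_v) → Aut(𝒞⊢_v)` and their one-object kind functors, AT THE GENUINE PLACE

S. Mochizuki, *Inter-universal Teichmüller theory I*, kurims manuscript (May 2020), §0 p. 33 ("isomorphism of
categories" = isomorphism class of equivalences), Example 3.3 (i) p. 78 ("`𝒟⊢_v` may be naturally regarded … as a full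
subcategory `𝒟⊢_v ⊆ 𝒟_v`"; "`𝒞⊢_v ⊆ 𝒞_v`"), Example 3.3 (iii) p. 79, verbatim: *"(a) the subcategory `𝒟⊢_v ⊆ 𝒟_v` may
be reconstructed category-theoretically from `𝒟_v` [cf. [AbsAnab], Lemma 1.3.8]"* (l. 33–35) and *"Note that it follows
immediately from the category-theoreticity of the divisor monoid `Φ_{𝒞_v}` [cf. [FrdI], Corollary 4.11, (iii); [FrdII],
Theorem 1.2, (i)], together with (a), (c), and the definition of `𝒞⊢_v` [cf. also [AbsAnab], Proposition 1.2.1, (v)],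
that (d) `𝒞⊢_v` may be reconstructed category-theoretically from `ℱ̲_v`."* (l. 46–51); Corollary 5.3 (iv) p. 144 l. 22–23
(*"the natural homomorphism `Aut(ℱ̲_v) → Aut(𝒟_v)`"*, print's phrase at `v ∈ 𝕍^bad` — the MODEL for our §0 reading
of (a)/(d) below as induced homomorphisms of `Aut(−)`, which is OURS, not a phrase of Example 3.3); Corollary 3.7
(ii)/(iii), Definition 3.6 (the passages `𝒟_v ↦ 𝒟⊢_v`, `ℱ̲_v ↦ ℱ⊢_v` of a Θ-Hodge theater) ([IUTchI] Ex 3.3 (iii) p.79)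
[claim: Mochizuki2012, status: disputed] (D-0012 claim key, status DISPUTED — nothing of the series is asserted; no side
is taken on [IUTchIII] Cor. 3.12).  (Doc-only revision: referee findings M26-F1/M26-F2 — quotation marks now enclose
verbatim print only; statements and proofs are byte-identical to the first landing.)

WHY.  abc-iut-L5-t2 typed clauses (a)/(d) as `GoodLocalFrobenioid.DdashFromD` / `CdashFromF` :=
`ReconstructibleAlong incl` / `ReconstructibleAlong CdashToC` (`SplitFrobenioids.lean`): every self-equivalence
DOWNSTAIRS has SOME self-equivalence UPSTAIRS over it — existence, no uniqueness, no homomorphism.  The slots of the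
«genuine ℱ-prime-strip kit» hub (abc-iut-L5-t2's `HodgeTheaterModel.dashOfBase` / `dashOf`, abc-iut-L5-t4's
`FKit.toFm`; design F1 of abc-iut-L5-t4's STEP-0 memo: kinds := `SingleObj (CatAut −)`) need these passages as FUNCTORS
of one-object kinds, i.e. as homomorphisms `Aut(𝒟_v) → Aut(𝒟⊢_v)`, `Aut(ℱ̲_v) → Aut(𝒞⊢_v)` in the §0 currency of
`CatIsomorphism` (p491065).  This file (seat abc-iut-w4-d047 gen 9; hub row R44 «E33III-ON-ISOS» FILE 2, L5-lead
REFEREE RULING #1 (4) / abc-iut-L5-t4 ARBITER NOTE #2 PIN (4)(a)) supplies them through the lift API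
`CatIsomorphism.ascendHom` / `liftKindFunctor` of `ConventionsCatIsomorphismLift.lean` (FILE 1):

* §1 (any `G : GoodLocalFrobenioid p K_v`) — (a): `ddashAscendHom G h : CatAut 𝒟_v →* CatAut 𝒟⊢_v` and
  `ddashKindFunctor` from `h : G.DdashFromD` ALONE (the uniqueness binder `LiftUnique incl incl` is FREE because
  `𝒟⊢_v ⊆ 𝒟_v` is full and faithful, `liftUnique_incl`); (d): `cdashAscendHom G h hu` / `cdashKindFunctor` from
  `h : G.CdashFromF` and a displayed `hu : LiftUnique CdashToC CdashToC`, plus the generic discharge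
  `liftUnique_cdashToC_of_morphismProperty` (a morphism property cutting out the hom-image of the faithful non-full
  `𝒞⊢_v ⊆ 𝒞_v` — this seat's `exists_iso_lift`, `ReconstructibleAlongNonFull.lean`);
* §2 — AT abc-iut-L1-t4's assembled object `ofKit`: `liftUnique_cdashToC_ofKit`, BINDER-FREE, from the layer-L1
  kernel theorems `GoodLocalKit.div_CdashToCOver_map_mem` / `exists_CdashToCOver_map_eq` /
  `respectsIso_div_mem_powers_logp_ofKit` BY NAME (the morphism property `Div(φ) ∈ ℕ·log(p_v)` of
  `GoodLocalFrobenioidOfKitCdashFromF.lean`); hence at the REAL-base object `ofGalois` (`liftUnique_cdashToC_ofGalois`);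
* §3 — AT THE PRINTED OBJECT `goodLocalFrobenioidOfEmb` and AT THE FINITE PLACE `v̲ = w ∣ p`
  (`goodLocalFrobenioidAt`, `K_v̲ := K_w`): `liftUnique_cdashToC_goodLocalFrobenioidOfEmb/At` (binder-free) and the
  two kind functors `InitialThetaData.ddashKindFunctorAt` / `cdashKindFunctorAt` with displayed binders EXACTLY those
  of this seat's one-call ★ p489406 (`hX` = Def. 3.1 (f); (a): `hΔ` = FACT F-0007 [AbsAnab] Lem. 1.3.8 in unfolded
  local shape; (d): `hX`, `hΔC` = FACT F-0004 first conjunct, `hΔ`, Galois-countability instance).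

0 new `Prop` fact, 0 instance, 0 notation, nothing of the landed files restated; typed ≠ inhabited ≠ proved; a kind
functor ON ISOMORPHISM CLASSES is OUR §0 reading of "reconstructed category-theoretically".
-/

noncomputable section

namespace Literature.IUT.HodgeTheaters

open CategoryTheory Literature.AnabelianGeometry.SemiGraphs Literature.AlgebraicGeometry.Frobenioids
open Literature.AlgebraicGeometry.Frobenioids.PadicFrd Literature.AnabelianGeometry.AbsoluteAnabelian
open Literature.NumberTheory.NumberFields IsDedekindDomain NumberField

universe u

namespace GoodLocalFrobenioid

/-! ### §1. The two induced homomorphisms (our §0 reading) for any inhabitant of the Ex. 3.3 interface -/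

section Generic

variable {p : ℕ} {Kv : Type} [Field Kv] [ValuativeRel Kv] (G : GoodLocalFrobenioid.{u} p Kv)

/-- Along the FULL, FAITHFUL `incl : 𝒟⊢_v ⥤ 𝒟_v` ([IUTchI] Ex. 3.3 (i)) two lifts of the same self-equivalence of
`𝒟_v` are isomorphic — the uniqueness binder of the lift API is free. ([IUTchI] Ex 3.3 (iii) (a) p.79) [claim: Mochizuki2012, status: disputed] -/
theorem liftUnique_incl : CatIsomorphism.LiftUnique G.incl G.incl :=
  CatIsomorphism.liftUnique_of_full_faithful

/-- abc-iut-L5-t2's clause (a) `DdashFromD` IS the existence binder `HasLift incl incl`.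
([IUTchI] Ex 3.3 (iii) (a) p.79) [claim: Mochizuki2012, status: disputed] -/
theorem hasLift_incl_of_ddashFromD (h : G.DdashFromD) : CatIsomorphism.HasLift G.incl G.incl :=
  (CatIsomorphism.hasLift_iff_reconstructibleAlong G.incl).2 h

/-- **[IUTchI] Ex. 3.3 (iii) (a) ON ISOMORPHISMS OF CATEGORIES — our §0 reading: the induced homomorphism
`Aut(𝒟_v) → Aut(𝒟⊢_v)`** (print says only that `𝒟⊢_v ⊆ 𝒟_v` "may be reconstructed category-theoretically from `𝒟_v`"):
the class of a self-equivalence of `𝒟_v` goes to the class of its (essentially unique) lift to the full subcategory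
`𝒟⊢_v`; from clause (a) `h : G.DdashFromD` ALONE. ([IUTchI] Ex 3.3 (iii) (a) p.79) [claim: Mochizuki2012, status: disputed] -/
def ddashAscendHom (h : G.DdashFromD) : CatAut G.Dv →* CatAut G.Ddash :=
  CatIsomorphism.ascendHom (G.hasLift_incl_of_ddashFromD h) G.liftUnique_incl

/-- `ddashAscendHom` on representatives: if `e'` lifts `e` along `incl` then `[e] ↦ [e']`.
([IUTchI] Ex 3.3 (iii) (a) p.79) [claim: Mochizuki2012, status: disputed] -/
theorem ddashAscendHom_mk (h : G.DdashFromD) {e : G.Dv ≌ G.Dv} {e' : G.Ddash ≌ G.Ddash}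
    (i : G.incl ⋙ e.functor ≅ e'.functor ⋙ G.incl) :
    G.ddashAscendHom h (CatIsomorphism.mk e) = CatIsomorphism.mk e' :=
  CatIsomorphism.ascend_mk (G.hasLift_incl_of_ddashFromD h) G.liftUnique_incl ⟨i.symm⟩

/-- **The passage `𝒟_v ↦ 𝒟⊢_v` as a functor of one-object kinds** (the slot `dashOfBase v` of abc-iut-L5-t2's
`HodgeTheaterModel` in design F1), from clause (a) alone. ([IUTchI] Ex 3.3 (iii) (a) p.79) [claim: Mochizuki2012, status: disputed] -/
def ddashKindFunctor (h : G.DdashFromD) : SingleObj (CatAut G.Dv) ⥤ SingleObj (CatAut G.Ddash) :=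
  CatIsomorphism.liftKindFunctor (G.hasLift_incl_of_ddashFromD h) G.liftUnique_incl

/-- On endomorphisms of the unique object `ddashKindFunctor` is `ddashAscendHom`.
([IUTchI] Ex 3.3 (iii) (a) p.79) [claim: Mochizuki2012, status: disputed] -/
theorem ddashKindFunctor_map (h : G.DdashFromD)
    (b : SingleObj.star (CatAut G.Dv) ⟶ SingleObj.star (CatAut G.Dv)) :
    (G.ddashKindFunctor h).map b = G.ddashAscendHom h b := rfl

/-- abc-iut-L5-t2's clause (d) `CdashFromF` IS the existence binder `HasLift CdashToC CdashToC`.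
([IUTchI] Ex 3.3 (iii) (d) p.79) [claim: Mochizuki2012, status: disputed] -/
theorem hasLift_cdashToC_of_cdashFromF (h : G.CdashFromF) : CatIsomorphism.HasLift G.CdashToC G.CdashToC :=
  (CatIsomorphism.hasLift_iff_reconstructibleAlong G.CdashToC).2 h

/-- **[IUTchI] Ex. 3.3 (iii) (d) ON ISOMORPHISMS OF CATEGORIES — our §0 reading: the induced homomorphism
`Aut(ℱ̲_v) → Aut(𝒞⊢_v)`** (print says only that `𝒞⊢_v` "may be reconstructed category-theoretically from `ℱ̲_v`"),
along the faithful, non-full `𝒞⊢_v ⊆ 𝒞_v`: from clause (d) `h : G.CdashFromF` and the displayed uniqueness binder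
`hu` (discharged below wherever the hom-image of `𝒞⊢_v ⊆ 𝒞_v` is cut out by a morphism property — in particular at
`ofKit`, `ofGalois` and at the genuine place, binder-free). ([IUTchI] Ex 3.3 (iii) (d) p.79) [claim: Mochizuki2012, status: disputed] -/
def cdashAscendHom (h : G.CdashFromF) (hu : CatIsomorphism.LiftUnique G.CdashToC G.CdashToC) :
    CatAut G.Cv →* CatAut G.Cdash :=
  CatIsomorphism.ascendHom (G.hasLift_cdashToC_of_cdashFromF h) hu

/-- `cdashAscendHom` on representatives: if `e'` lifts `e` along `𝒞⊢_v ⊆ 𝒞_v` then `[e] ↦ [e']`.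
([IUTchI] Ex 3.3 (iii) (d) p.79) [claim: Mochizuki2012, status: disputed] -/
theorem cdashAscendHom_mk (h : G.CdashFromF) (hu : CatIsomorphism.LiftUnique G.CdashToC G.CdashToC)
    {e : G.Cv ≌ G.Cv} {e' : G.Cdash ≌ G.Cdash} (i : G.CdashToC ⋙ e.functor ≅ e'.functor ⋙ G.CdashToC) :
    G.cdashAscendHom h hu (CatIsomorphism.mk e) = CatIsomorphism.mk e' :=
  CatIsomorphism.ascend_mk (G.hasLift_cdashToC_of_cdashFromF h) hu ⟨i.symm⟩

/-- **The passage `ℱ̲_v = 𝒞_v ↦ 𝒞⊢_v` as a functor of one-object kinds** (the category half of the slots `dashOf v` /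
`toFm v`), from clause (d) and the uniqueness binder. ([IUTchI] Ex 3.3 (iii) (d) p.79) [claim: Mochizuki2012, status: disputed] -/
def cdashKindFunctor (h : G.CdashFromF) (hu : CatIsomorphism.LiftUnique G.CdashToC G.CdashToC) :
    SingleObj (CatAut G.Cv) ⥤ SingleObj (CatAut G.Cdash) :=
  CatIsomorphism.liftKindFunctor (G.hasLift_cdashToC_of_cdashFromF h) hu

/-- On endomorphisms of the unique object `cdashKindFunctor` is `cdashAscendHom`.
([IUTchI] Ex 3.3 (iii) (d) p.79) [claim: Mochizuki2012, status: disputed] -/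
theorem cdashKindFunctor_map (h : G.CdashFromF) (hu : CatIsomorphism.LiftUnique G.CdashToC G.CdashToC)
    (b : SingleObj.star (CatAut G.Cv) ⟶ SingleObj.star (CatAut G.Cv)) :
    (G.cdashKindFunctor h hu).map b = G.cdashAscendHom h hu b := rfl

/-- **Generic discharge of the uniqueness binder for `𝒞⊢_v ⊆ 𝒞_v`**: if the hom-image of the faithful `CdashToC` is cut
out by an iso-stable morphism property `P` of `𝒞_v` (`hPΦ`: images satisfy `P`; `hlift`: `P`-morphisms between image
objects lift), then isomorphisms between image objects lift (this seat's `exists_iso_lift`) and `LiftUnique` holds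
(`CatIsomorphism.liftUnique_of_faithful_of_iso_lift`). ([IUTchI] Ex 3.3 (iii) (d) p.79) [claim: Mochizuki2012, status: disputed] -/
theorem liftUnique_cdashToC_of_morphismProperty (P : MorphismProperty G.Cv) [P.RespectsIso]
    (hPΦ : ∀ {t₁ t₂ : G.Cdash} (f : t₁ ⟶ t₂), P (G.CdashToC.map f))
    (hlift : ∀ {t₁ t₂ : G.Cdash} (g : G.CdashToC.obj t₁ ⟶ G.CdashToC.obj t₂), P g →
      ∃ f : t₁ ⟶ t₂, G.CdashToC.map f = g) :
    CatIsomorphism.LiftUnique G.CdashToC G.CdashToC :=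
  CatIsomorphism.liftUnique_of_faithful_of_iso_lift fun s => exists_iso_lift G.CdashToC P hPΦ hlift s

end Generic

/-! ### §2. The uniqueness binder for (d) DISCHARGED at `ofKit` (layer-L1 kernel theorems) and at `ofGalois` -/

section OfKit

variable {p : ℕ} [Fact p.Prime] {Dv Dd : Type u} [Category.{u} Dv] [Category.{u} Dd]
  (incl : Dd ⥤ Dv) (proj : Dv ⥤ Dd) (adj : proj ⊣ incl)
  (base : Dd ⥤ PadicFld.{u} p) (hloc : ∀ A : Dd, (base.obj A).IsPadicLocal)
  (hc : IsConnected Dd) (he : IsTotallyEpimorphic Dd) (hcV : IsConnected Dv) (heV : IsTotallyEpimorphic Dv)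
  (Kv : Type) [Field Kv] [ValuativeRel Kv] (hp : ((p : Kv)) ∈ PadicFrd.intNonzero Kv) [incl.Full] [incl.Faithful]

/-- **`LiftUnique` for `𝒞⊢_v ⊆ 𝒞_v` at abc-iut-L1-t4's assembled object `ofKit`, BINDER-FREE**: the hom-image of the
faithful non-full inclusion is cut out by the property `Div(φ) ∈ ℕ·log(p_v)` (layer L1: `GoodLocalKit.div_CdashToCOver_map_mem`,
`exists_CdashToCOver_map_eq`, `respectsIso_div_mem_powers_logp_ofKit`; [IUTchI] Ex. 3.3 (i) p. 78 l. 29–32: "an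
absolutely primitive [cf. [FrdII], Example 1.1, (ii)] submonoid `Φ_{C⊢_v} ⊆ Φ_{C_v}|_{D⊢_v}`", the notion "absolutely
primitive" being [FrdII] Ex. 1.1 (ii)'s), so two lifts of the same self-equivalence of `𝒞_v` to `𝒞⊢_v` are isomorphic.
([IUTchI] Ex 3.3 (iii) (d) p.79) [claim: Mochizuki2012, status: disputed] -/
theorem liftUnique_cdashToC_ofKit :
    CatIsomorphism.LiftUnique (ofKit incl proj adj base hloc hc he hcV heV Kv hp).CdashToC
      (ofKit incl proj adj base hloc hc he hcV heV Kv hp).CdashToC := by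
  haveI : IsIso adj.counit := inferInstance
  haveI := respectsIso_div_mem_powers_logp_ofKit incl proj adj base hloc hc he hcV heV Kv hp
  exact liftUnique_cdashToC_of_morphismProperty (ofKit incl proj adj base hloc hc he hcV heV Kv hp)
    (fun X _ φ => (ModelFrobenioid.Hom.div φ).1 ∈ Submonoid.powers (primGen (proj ⋙ base) X.base))
    (fun f => GoodLocalKit.div_CdashToCOver_map_mem base hloc hc he proj (hlocOver proj base hloc) hcV heV incl
      adj.counit f)
    (fun g hg => GoodLocalKit.exists_CdashToCOver_map_eq base hloc hc he proj (hlocOver proj base hloc) hcV heV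
      incl adj.counit g hg)

/-- At `ofKit`, the induced homomorphism `Aut(ℱ̲_v) → Aut(𝒞⊢_v)` (our §0 reading of (d)) therefore needs clause (d) ONLY.
([IUTchI] Ex 3.3 (iii) (d) p.79) [claim: Mochizuki2012, status: disputed] -/
def cdashAscendHomOfKit (h : (ofKit incl proj adj base hloc hc he hcV heV Kv hp).CdashFromF) :
    CatAut (ofKit incl proj adj base hloc hc he hcV heV Kv hp).Cv →*
      CatAut (ofKit incl proj adj base hloc hc he hcV heV Kv hp).Cdash :=
  (ofKit incl proj adj base hloc hc he hcV heV Kv hp).cdashAscendHom h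
    (liftUnique_cdashToC_ofKit incl proj adj base hloc hc he hcV heV Kv hp)

end OfKit

section OfGalois

variable {p : ℕ} [Fact p.Prime] (d : GaloisValDatum.{u} p) {P : Type u} [Group P] [TopologicalSpace P]
  (aug : P →* d.Gal) (hc : Continuous aug) (hs : Function.Surjective aug) (ho : IsOpenMap aug)
  (Kv : Type) [Field Kv] [ValuativeRel Kv] (hp : ((p : Kv)) ∈ PadicFrd.intNonzero Kv)

/-- **`LiftUnique` for `𝒞⊢_v ⊆ 𝒞_v` over the REAL bases `𝓑(Π_v)⁰ ⊇ 𝓑(G_v)⁰`** (`ofGalois`), binder-free.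
([IUTchI] Ex 3.3 (iii) (d) p.79) [claim: Mochizuki2012, status: disputed] -/
theorem liftUnique_cdashToC_ofGalois :
    CatIsomorphism.LiftUnique (ofGalois d aug hc hs ho Kv hp).CdashToC (ofGalois d aug hc hs ho Kv hp).CdashToC := by
  haveI := CosetCat.pull_full aug hc hs
  haveI := CosetCat.pull_faithful aug hc hs
  exact liftUnique_cdashToC_ofKit (CosetCat.pull aug hc hs) (CosetCat.push aug ho) (CosetCat.pushPullAdj aug hc hs ho)
    d.fieldFunctor d.fieldFunctor_isPadicLocal CosetCat.isConnected CosetCat.isTotallyEpimorphic CosetCat.isConnected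
    CosetCat.isTotallyEpimorphic Kv hp

end OfGalois

end GoodLocalFrobenioid

/-! ### §3. At the printed object `goodLocalFrobenioidOfEmb` and AT THE FINITE PLACE `v̲ = w ∣ p` of `K` -/

section Datum

variable {F : Type u} {K : Type} {Fbar : Type} [Field F] [NumberField F] [Field K] [NumberField K]
  [Algebra F K] [Field Fbar] [Algebra F Fbar] [Algebra K Fbar] [IsScalarTower F K Fbar] [Normal K Fbar]
  {E : WeierstrassCurve F} [E.IsElliptic] {l : ℕ} {Pb : BadPlacePredicates K}
  (D : InitialThetaData F K Fbar E l Pb) (p : ℕ) [Fact p.Prime]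
  (k : Type) [NontriviallyNormedField k] [CompleteSpace k] [IsUltrametricDist k] [NormedAlgebra ℚ_[p] k]
  [FiniteDimensional ℚ_[p] k] [Algebra K k]

namespace InitialThetaData

/-- **`LiftUnique` for `𝒞⊢_v̲ ⊆ 𝒞_v̲` AT THE PRINTED OBJECT** `goodLocalFrobenioidOfEmb` (`K_v̲ = k`,
`Π_v̲ := Π_{X̲→_K} ×_{G_K} Gal(k̄/k)` along `ι`), binder-free beyond the datum's openness `hX` that builds the object.
([IUTchI] Ex 3.3 (iii) (d) p.79) [claim: Mochizuki2012, status: disputed] -/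
theorem liftUnique_cdashToC_goodLocalFrobenioidOfEmb (ι : Fbar →ₐ[K] AlgebraicClosure k)
    (hX : IsOpen (D.PiXarrow : Set D.PiC)) :
    CatIsomorphism.LiftUnique
      (@GoodLocalFrobenioid.CdashToC p k _ (GaloisValDatum.normVal k) (D.goodLocalFrobenioidOfEmb p k ι hX))
      (@GoodLocalFrobenioid.CdashToC p k _ (GaloisValDatum.normVal k) (D.goodLocalFrobenioidOfEmb p k ι hX)) := by
  letI := GaloisValDatum.normVal k
  exact GoodLocalFrobenioid.liftUnique_cdashToC_ofGalois (GaloisValDatum.ofComplete p k) _ _ _ _ k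
    (GaloisValDatum.p_mem_normVal p k)

end InitialThetaData

end Datum

section Place

variable {F : Type u} {K : Type} {Fbar : Type} [Field F] [NumberField F] [Field K] [NumberField K]
  [Algebra F K] [Field Fbar] [Algebra F Fbar] [Algebra K Fbar] [IsScalarTower F K Fbar] [Normal K Fbar]
  {E : WeierstrassCurve F} [E.IsElliptic] {l : ℕ} {Pb : BadPlacePredicates K}
  (D : InitialThetaData F K Fbar E l Pb) (w : HeightOneSpectrum (𝓞 K)) (p : ℕ) [Fact p.Prime]
  (hw : ((p : ℕ) : 𝓞 K) ∈ w.asIdeal)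

namespace InitialThetaData

/-- **`LiftUnique` for `𝒞⊢_v̲ ⊆ 𝒞_v̲` AT THE FINITE PLACE `v̲ = w ∣ p`** (`goodLocalFrobenioidAt`, `K_v̲ := K_w`),
binder-free beyond `hX`. ([IUTchI] Ex 3.3 (iii) (d) p.79) [claim: Mochizuki2012, status: disputed] -/
theorem liftUnique_cdashToC_goodLocalFrobenioidAt (hX : IsOpen (D.PiXarrow : Set D.PiC)) :
    CatIsomorphism.LiftUnique
      (@GoodLocalFrobenioid.CdashToC p (RescaledCompletion K p w hw) _
        (GaloisValDatum.normVal (RescaledCompletion K p w hw)) (D.goodLocalFrobenioidAt w p hw hX))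
      (@GoodLocalFrobenioid.CdashToC p (RescaledCompletion K p w hw) _
        (GaloisValDatum.normVal (RescaledCompletion K p w hw)) (D.goodLocalFrobenioidAt w p hw hX)) := by
  letI : Algebra K (RescaledCompletion K p w hw) := inferInstanceAs (Algebra K (w.adicCompletion K))
  haveI := GaloisValDatum.finiteDimensional_rescaledCompletion K p w hw
  exact D.liftUnique_cdashToC_goodLocalFrobenioidOfEmb p (RescaledCompletion K p w hw)
    (localEmb (K := K) (Fbar := Fbar) (AlgebraicClosure (RescaledCompletion K p w hw))) hX

/-- **[IUTchI] Ex. 3.3 (iii) (a) AS A KIND FUNCTOR AT THE PLACE `v̲ = w ∣ p`**: `𝒟_v̲ ↦ 𝒟⊢_v̲` on one-object kinds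
(`SingleObj (CatAut 𝓑(Π_v̲)⁰) ⥤ SingleObj (CatAut 𝓑(G_v̲)⁰)`) for the genuine datum `goodLocalFrobenioidAt`, GIVEN the
Galois-countability of `Π_{C_F}`, the datum's openness `hX` (Def. 3.1 (f)) and [AbsAnab] Lem. 1.3.8 in the shape `hΔ`
(FACT F-0007) — the binders of this seat's `ddashFromD_goodLocalFrobenioidAt_of_forall_map_ker`, nothing more.
([IUTchI] Ex 3.3 (iii) (a) p.79) [claim: Mochizuki2012, status: disputed] -/
def ddashKindFunctorAt [SecondCountableTopology D.PiC] (hX : IsOpen (D.PiXarrow : Set D.PiC))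
    (hΔ : letI : Algebra K (RescaledCompletion K p w hw) := inferInstanceAs (Algebra K (w.adicCompletion K))
      ∀ φ : D.PiLoc D.PiXarrow (localToGF F (RescaledCompletion K p w hw)
          (localEmb (K := K) (Fbar := Fbar) (AlgebraicClosure (RescaledCompletion K p w hw)))) ≃ₜ*
        D.PiLoc D.PiXarrow (localToGF F (RescaledCompletion K p w hw)
          (localEmb (K := K) (Fbar := Fbar) (AlgebraicClosure (RescaledCompletion K p w hw)))),
      (D.augLoc D.PiXarrow (localToGF F (RescaledCompletion K p w hw)
          (localEmb (K := K) (Fbar := Fbar) (AlgebraicClosure (RescaledCompletion K p w hw))))).ker.map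
          φ.toMulEquiv.toMonoidHom =
        (D.augLoc D.PiXarrow (localToGF F (RescaledCompletion K p w hw)
          (localEmb (K := K) (Fbar := Fbar) (AlgebraicClosure (RescaledCompletion K p w hw))))).ker) :
    SingleObj (CatAut (@GoodLocalFrobenioid.Dv p (RescaledCompletion K p w hw) _
        (GaloisValDatum.normVal (RescaledCompletion K p w hw)) (D.goodLocalFrobenioidAt w p hw hX))) ⥤
      SingleObj (CatAut (@GoodLocalFrobenioid.Ddash p (RescaledCompletion K p w hw) _
        (GaloisValDatum.normVal (RescaledCompletion K p w hw)) (D.goodLocalFrobenioidAt w p hw hX))) :=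
  @GoodLocalFrobenioid.ddashKindFunctor p (RescaledCompletion K p w hw) _
    (GaloisValDatum.normVal (RescaledCompletion K p w hw)) (D.goodLocalFrobenioidAt w p hw hX)
    (D.ddashFromD_goodLocalFrobenioidAt_of_forall_map_ker w p hw hX hΔ)

/-- **[IUTchI] Ex. 3.3 (iii) (d) AS A KIND FUNCTOR AT THE PLACE `v̲ = w ∣ p`**: `ℱ̲_v̲ = 𝒞_v̲ ↦ 𝒞⊢_v̲` on one-object
kinds for the genuine datum, GIVEN Galois-countability, `hX`, `Δ_C` slim (`hΔC`, FACT F-0004 first conjunct) and `hΔ`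
(FACT F-0007) — the binders of this seat's `cdashFromF_goodLocalFrobenioidAt`; the uniqueness half is the binder-free
`liftUnique_cdashToC_goodLocalFrobenioidAt`. ([IUTchI] Ex 3.3 (iii) (d) p.79) [claim: Mochizuki2012, status: disputed] -/
def cdashKindFunctorAt [SecondCountableTopology D.PiC] (hX : IsOpen (D.PiXarrow : Set D.PiC))
    (hΔC : IsSlimGroup D.DeltaC)
    (hΔ : letI : Algebra K (RescaledCompletion K p w hw) := inferInstanceAs (Algebra K (w.adicCompletion K))
      ∀ φ : D.PiLoc D.PiXarrow (localToGF F (RescaledCompletion K p w hw)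
          (localEmb (K := K) (Fbar := Fbar) (AlgebraicClosure (RescaledCompletion K p w hw)))) ≃ₜ*
        D.PiLoc D.PiXarrow (localToGF F (RescaledCompletion K p w hw)
          (localEmb (K := K) (Fbar := Fbar) (AlgebraicClosure (RescaledCompletion K p w hw)))),
      (D.augLoc D.PiXarrow (localToGF F (RescaledCompletion K p w hw)
          (localEmb (K := K) (Fbar := Fbar) (AlgebraicClosure (RescaledCompletion K p w hw))))).ker.map
          φ.toMulEquiv.toMonoidHom =
        (D.augLoc D.PiXarrow (localToGF F (RescaledCompletion K p w hw)
          (localEmb (K := K) (Fbar := Fbar) (AlgebraicClosure (RescaledCompletion K p w hw))))).ker) :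
    SingleObj (CatAut (@GoodLocalFrobenioid.Cv p (RescaledCompletion K p w hw) _
        (GaloisValDatum.normVal (RescaledCompletion K p w hw)) (D.goodLocalFrobenioidAt w p hw hX))) ⥤
      SingleObj (CatAut (@GoodLocalFrobenioid.Cdash p (RescaledCompletion K p w hw) _
        (GaloisValDatum.normVal (RescaledCompletion K p w hw)) (D.goodLocalFrobenioidAt w p hw hX))) :=
  @GoodLocalFrobenioid.cdashKindFunctor p (RescaledCompletion K p w hw) _
    (GaloisValDatum.normVal (RescaledCompletion K p w hw)) (D.goodLocalFrobenioidAt w p hw hX)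
    (D.cdashFromF_goodLocalFrobenioidAt w p hw hX hΔC hΔ) (D.liftUnique_cdashToC_goodLocalFrobenioidAt w p hw hX)

end InitialThetaData

end Place

end Literature.IUT.HodgeTheaters

end
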